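import HarnessLib
import Summits.RiemannHypothesis.RiemannHypothesis.Theorems.SignConePointwiseCheckerH

/-!
# Route SignCone: soundness of the pointwise checker with an out-of-window correction `H`

Support for the unconditional rungs of `SignConeOscillatory` / `SignConeInequality`
(items stmt-RiemannHypothesis-16302 / 16301). Soundness of the checks of `SignConePointwiseCheckerH.lean`
for the corrected density `F_D + H`:

* `point_boundH`: `f − slopeH·|y − u| ≤ F_D(y) + H(y)` at a point `u` where `flTH` returns `f`
  (`point_bound` of the fast checker + enclosure and Lipschitz constant of `H`);
* `gridFromH_sound`, `agrid₂H_sound`, `chain₂H_sound` (two-point cells, anchors, chaining, as in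
  `SignConePointwiseCheckerFastSound.lean`);
* `tailH_sound`: beyond `Y₀` the Dirichlet-SOS bound `comb − Hsos ≤ sosBound`
  (`SignConePointwiseSOSTailBound.lean`) replaces `cos ≤ 1`;
* **`PWData.F_add_Hsos_nonneg_of_checks`**: scalar checks (at any `Y₁`; their own tail clause is not
  used) + tables + correction-list check + SOS tail check at `Y₀` + passing anchored grids chaining from
  `0` to `Y₀` imply `∀ y, 0 ≤ F_D(y) + Z.Hsos y`.
-/

noncomputable section

-- `Summit.RiemannHypothesis.RiemannHypothesis.…` repeats a namespace component by design (D-0017 layout).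
set_option linter.dupNamespace false

open Real

namespace Summit.RiemannHypothesis.RiemannHypothesis.Theorems.SignCone

open Literature.Analysis.ValidatedNumerics.Numerics Literature.NumberTheory.LFunctions
open Literature.Analysis.SpecialFunctions (reDigammaQuarter reDigammaQuarter_mono reDigammaQuarter_even)

/-! ## A sparse correction list: merged orientations, zero class sums dropped -/

namespace SOSData

variable (Z : SOSData)

/-- The gram matrix is symmetric. [folklore] -/
theorem gram_comm (n m : ℕ) : Z.gram n m = Z.gram m n := by
  unfold gram; congr 1; funext i; ring

/-- Class sums are symmetric. [folklore] -/
theorem classSum_comm (p q : ℕ) : Z.classSum p q = Z.classSum q p := by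
  unfold classSum; rw [max_comm]; congr 1; funext t; rw [gram_comm]

/-- **The sparse correction list**: one term `(2C_{pq}/4^S) cos(y(log p − log q))` per out-class with
`p > q` and `C_{pq} ≠ 0` (the orientation `(q, p)` has the same class sum and the same cosine). [folklore] -/
def hlist₂ : List HTerm :=
  (List.range Z.Np).flatMap fun p' => (List.range Z.Np).flatMap fun q' =>
    if (Nat.Coprime (p' + 1) (q' + 1) ∧ Z.isOut (p' + 1) (q' + 1) = true) ∧ (q' < p' ∧
        Z.classSum (p' + 1) (q' + 1) ≠ 0) then
      [⟨p' + 1, q' + 1, 2 * (Z.classSum (p' + 1) (q' + 1) / 4 ^ Z.S)⟩] else []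

/-- Entries of `hlist₂` lie in `[1, Np]`. [folklore] -/
theorem mem_hlist₂ {t : HTerm} (ht : t ∈ Z.hlist₂) : (1 ≤ t.p ∧ t.p ≤ Z.Np) ∧ (1 ≤ t.q ∧ t.q ≤ Z.Np) := by
  unfold hlist₂ at ht
  simp only [List.mem_flatMap, List.mem_range] at ht
  obtain ⟨p', hp', q', hq', hm⟩ := ht
  split at hm
  · simp only [List.mem_singleton] at hm
    subst hm
    exact ⟨⟨Nat.succ_pos _, by show p' + 1 ≤ Z.Np; omega⟩, Nat.succ_pos _, by show q' + 1 ≤ Z.Np; omega⟩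
  · simp at hm

/-- The (shifted, coprime-weighted) summand of `Hsos`. [folklore] -/
def hsummand (y : ℝ) (p' q' : ℕ) : ℝ :=
  if Nat.Coprime (p' + 1) (q' + 1) then
    (if Z.isOut (p' + 1) (q' + 1) = true then
      ((Z.classSum (p' + 1) (q' + 1) / 4 ^ Z.S : ℚ) : ℝ) *
        Real.cos (y * (Real.log ((p' + 1 : ℕ) : ℝ) - Real.log ((q' + 1 : ℕ) : ℝ))) else 0) else 0

/-- `Hsos` as a double sum over `range Np × range Np`. [folklore] -/
theorem Hsos_eq_sum_range (y : ℝ) :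
    Z.Hsos y = ∑ p' ∈ Finset.range Z.Np, ∑ q' ∈ Finset.range Z.Np, Z.hsummand y p' q' := by
  classical
  unfold Hsos ratioClasses hsummand
  rw [Finset.sum_filter, Finset.sum_product, ← Finset.Ico_add_one_right_eq_Icc, Finset.sum_Ico_eq_sum_range]
  refine Finset.sum_congr (by simp) fun p' _ => ?_
  rw [Finset.sum_Ico_eq_sum_range]
  refine Finset.sum_congr (by simp) fun q' _ => ?_
  rw [Nat.add_comm 1 p', Nat.add_comm 1 q']

/-- The summand is symmetric. [folklore] -/
theorem hsummand_comm (y : ℝ) (p' q' : ℕ) : Z.hsummand y p' q' = Z.hsummand y q' p' := by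
  unfold hsummand
  by_cases h1 : Nat.Coprime (p' + 1) (q' + 1)
  · have h2 : Nat.Coprime (q' + 1) (p' + 1) := Nat.coprime_comm.1 h1
    rw [if_pos h1, if_pos h2, isOut_comm, classSum_comm]
    split_ifs
    · congr 1; rw [← Real.cos_neg]; congr 1; ring
    · rfl
  · have h2 : ¬ Nat.Coprime (q' + 1) (p' + 1) := fun h => h1 (Nat.coprime_comm.1 h)
    rw [if_neg h1, if_neg h2]

/-- The summand vanishes on the diagonal when `1 < T`. [folklore] -/
theorem hsummand_diag (hT : 1 < Z.T) (y : ℝ) (p' : ℕ) : Z.hsummand y p' p' = 0 := by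
  unfold hsummand
  by_cases hc : Nat.Coprime (p' + 1) (p' + 1)
  · rw [if_pos hc]
    have h1 : p' + 1 = 1 := by simpa [Nat.coprime_self] using hc
    have hout : Z.isOut (p' + 1) (p' + 1) = false := by
      rw [h1]
      unfold isOut
      simp only [Nat.cast_one, mul_one, Bool.or_self, decide_eq_false_iff_not, not_le]
      exact hT
    rw [hout]
    simp
  · rw [if_neg hc]

/-- `Hval Z.hlist₂ = Z.Hsos` (for `1 < T`). [folklore] -/
theorem Hval_hlist₂ (hT : 1 < Z.T) (y : ℝ) : Hval Z.hlist₂ y = Z.Hsos y := by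
  classical
  -- the list as the strictly-lower-triangular double sum of 2·summand
  have hL : Hval Z.hlist₂ y = ∑ p' ∈ Finset.range Z.Np, ∑ q' ∈ Finset.range Z.Np,
      if q' < p' then 2 * Z.hsummand y p' q' else 0 := by
    unfold Hval hlist₂
    rw [List.flatMap_def, List.map_flatten, List.sum_flatten, List.map_map, List.map_map,
      ← List.sum_toFinset _ (List.nodup_range), List.toFinset_range]
    refine Finset.sum_congr rfl fun p' _ => ?_
    simp only [Function.comp_apply]
    rw [List.flatMap_def, List.map_flatten, List.sum_flatten, List.map_map, List.map_map,
      ← List.sum_toFinset _ (List.nodup_range), List.toFinset_range]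
    refine Finset.sum_congr rfl fun q' _ => ?_
    simp only [Function.comp_apply]
    unfold hsummand
    by_cases hlt : q' < p'
    · rw [if_pos hlt]
      by_cases hc : Nat.Coprime (p' + 1) (q' + 1) ∧ Z.isOut (p' + 1) (q' + 1) = true
      · by_cases hz : Z.classSum (p' + 1) (q' + 1) ≠ 0
        · rw [if_pos ⟨hc, hlt, hz⟩, if_pos hc.1, if_pos hc.2]
          simp only [List.map_cons, List.map_nil, List.sum_cons, List.sum_nil, add_zero]
          push_cast; ring
        · rw [if_neg (fun h => hz h.2.2), if_pos hc.1, if_pos hc.2]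
          push Not at hz
          simp [hz]
      · rw [if_neg (fun h => hc h.1)]
        simp only [List.map_nil, List.sum_nil]
        by_cases h1 : Nat.Coprime (p' + 1) (q' + 1)
        · rw [if_pos h1, if_neg (fun h2 => hc ⟨h1, h2⟩)]; simp
        · rw [if_neg h1]; simp
    · rw [if_neg hlt, if_neg (fun h => hlt h.2.1)]
      simp
  -- symmetrise the full double sum
  rw [hL, Hsos_eq_sum_range]
  set R := Finset.range Z.Np
  have htri : ∀ p' q' : ℕ, Z.hsummand y p' q' = (if q' < p' then Z.hsummand y p' q' else 0) +
      (if p' < q' then Z.hsummand y p' q' else 0) + (if p' = q' then Z.hsummand y p' q' else 0) := by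
    intro p' q'
    rcases lt_trichotomy q' p' with h | h | h
    · rw [if_pos h, if_neg (lt_asymm h), if_neg (ne_of_gt h)]; ring
    · subst h; rw [if_neg (lt_irrefl _), if_pos rfl]; ring
    · rw [if_neg (lt_asymm h), if_pos h, if_neg (ne_of_lt h)]; ring
  have hsplit : ∑ p' ∈ R, ∑ q' ∈ R, Z.hsummand y p' q' =
      (∑ p' ∈ R, ∑ q' ∈ R, if q' < p' then Z.hsummand y p' q' else 0) +
      (∑ p' ∈ R, ∑ q' ∈ R, if p' < q' then Z.hsummand y p' q' else 0) +
      (∑ p' ∈ R, ∑ q' ∈ R, if p' = q' then Z.hsummand y p' q' else 0) := by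
    rw [← Finset.sum_add_distrib, ← Finset.sum_add_distrib]
    refine Finset.sum_congr rfl fun p' _ => ?_
    rw [← Finset.sum_add_distrib, ← Finset.sum_add_distrib]
    exact Finset.sum_congr rfl fun q' _ => htri p' q'
  have hupper : (∑ p' ∈ R, ∑ q' ∈ R, if p' < q' then Z.hsummand y p' q' else 0) =
      ∑ p' ∈ R, ∑ q' ∈ R, if q' < p' then Z.hsummand y p' q' else 0 := by
    rw [Finset.sum_comm]
    refine Finset.sum_congr rfl fun p' _ => Finset.sum_congr rfl fun q' _ => ?_
    split_ifs with h
    · exact hsummand_comm Z y _ _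
    · rfl
  have hdiag : (∑ p' ∈ R, ∑ q' ∈ R, if p' = q' then Z.hsummand y p' q' else 0) = 0 := by
    refine Finset.sum_eq_zero fun p' _ => Finset.sum_eq_zero fun q' _ => ?_
    split_ifs with h
    · subst h; exact hsummand_diag Z hT y _
    · rfl
  rw [hsplit, hupper, hdiag, add_zero, ← two_mul, Finset.mul_sum]
  refine Finset.sum_congr rfl fun p' _ => ?_
  rw [Finset.mul_sum]
  refine Finset.sum_congr rfl fun q' _ => ?_
  split_ifs <;> simp

end SOSData

namespace PWData

variable {D : PWData}

/-- The SPARSE correction list is the certificate's, and its indices are covered by the log table. [folklore] -/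
def checkHTerms₂ (D : PWData) (Z : SOSData) (hl : List HTerm) : Bool :=
  decide (hl = Z.hlist₂) && decide (Z.Np ≤ D.logN) && decide (1 < Z.T)

/-- Unpacking `checkHTerms₂`. [folklore] -/
theorem checkHTerms₂_spec {Z : SOSData} {hl : List HTerm} (h : D.checkHTerms₂ Z hl = true) :
    hl = Z.hlist₂ ∧ (∀ t ∈ hl, (1 ≤ t.p ∧ t.p ≤ D.logN) ∧ (1 ≤ t.q ∧ t.q ≤ D.logN)) ∧ 1 < Z.T := by
  unfold checkHTerms₂ at h
  simp only [Bool.and_eq_true, decide_eq_true_eq] at h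
  obtain ⟨⟨rfl, hN⟩, hT⟩ := h
  refine ⟨rfl, fun t ht => ?_, hT⟩
  have hm := Z.mem_hlist₂ ht
  exact ⟨⟨hm.1.1, hm.1.2.trans hN⟩, hm.2.1, hm.2.2.trans hN⟩

end PWData

namespace PWData

variable {D : PWData}

/-- Unpacking `checkHTerms`: the list is the certificate's and its indices are covered by the table. [folklore] -/
theorem checkHTerms_spec {Z : SOSData} {hl : List HTerm} (h : D.checkHTerms Z hl = true) :
    hl = Z.hlist ∧ ∀ t ∈ hl, (1 ≤ t.p ∧ t.p ≤ D.logN) ∧ (1 ≤ t.q ∧ t.q ≤ D.logN) := by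
  unfold checkHTerms at h
  simp only [Bool.and_eq_true, decide_eq_true_eq] at h
  obtain ⟨rfl, hN⟩ := h
  refine ⟨rfl, fun t ht => ?_⟩
  have hm := Z.mem_hlist ht
  exact ⟨⟨hm.1.1, hm.1.2.trans hN⟩, hm.2.1, hm.2.2.trans hN⟩

/-- **Point bound with `H`.** If `flTH` returns `f` at `u` (genuine tables, covered correction list),
then for every `y` with `w ≤ Re ψ(1/4 + iy/2)`: `f − slopeH·|y − u| ≤ F_D(y) + H(y)`. [folklore] -/
theorem point_boundH {Y0 : ℚ} (h : D.checkScalars Y0 = true) {cs : List (FI × FI)} {logs : List FI}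
    (ht : D.tablesOK cs logs = true) {hl : List HTerm}
    (hhl : ∀ t ∈ hl, (1 ≤ t.p ∧ t.p ≤ D.logN) ∧ (1 ≤ t.q ∧ t.q ≤ D.logN))
    {w u f : ℚ} (hf : D.flTH cs logs hl w u = some f) (y : ℝ)
    (hw : ((w : ℚ) : ℝ) ≤ reDigammaQuarter y) :
    (f : ℝ) - D.slopeH logs hl * |y - u| ≤ D.F y + Hval hl y := by
  obtain ⟨-, -, -, -, hlog, -⟩ := check_spec h
  have hlogs : logs = FI.logTable D.logN := by
    unfold tablesOK at ht
    rw [Bool.and_eq_true, decide_eq_true_eq, decide_eq_true_eq] at ht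
    exact ht.2
  unfold flTH at hf
  cases hf0 : D.flT cs logs w u with
  | none => rw [hf0] at hf; simp at hf
  | some f0 =>
    rw [hf0] at hf
    simp only [Option.map_some, Option.some.injEq] at hf
    subst hf
    have hp := point_bound h ht hf0 y hw
    -- H(u) ≥ its enclosure's lower end, and H is Lipschitz
    have hHu : (((PW.HFI hl logs u).loQ : ℚ) : ℝ) ≤ Hval hl u := by
      rw [hlogs]
      exact FI.loQ_le (PW.mem_HFI hlog hl (fun t ht' => ⟨(hhl t ht').1.2, (hhl t ht').2.2⟩) u)
    have hLip : Hval hl u - Hval hl y ≤ (PW.HlipQ logs hl : ℝ) * |y - u| := by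
      rw [hlogs, abs_sub_comm]
      exact PW.Hval_sub_le hlog hl hhl u y
    unfold slopeH
    push_cast
    nlinarith [hp, hHu, hLip, abs_nonneg (y - (u : ℝ))]

/-- **Soundness of the two-point cells with `H`.** [folklore] -/
theorem gridFromH_sound {Y0 : ℚ} (h : D.checkScalars Y0 = true) {cs : List (FI × FI)} {logs : List FI}
    (ht : D.tablesOK cs logs = true) {hl : List HTerm}
    (hhl : ∀ t ∈ hl, (1 ≤ t.p ∧ t.p ≤ D.logN) ∧ (1 ≤ t.q ∧ t.q ≤ D.logN)) (w : ℚ) :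
    ∀ (rest : List ℚ) (u fu : ℚ), D.flTH cs logs hl w u = some fu →
      (∀ y : ℝ, (u : ℝ) ≤ y → ((w : ℚ) : ℝ) ≤ reDigammaQuarter y) →
      D.checkGridFromH cs logs hl (D.slopeH logs hl) w u fu rest = true →
      u ≤ lastQ (u :: rest) ∧ ∀ y : ℝ, (u : ℝ) ≤ y → y ≤ lastQ (u :: rest) → rest ≠ [] → 0 ≤ D.F y + Hval hl y
  | [], u, _, _, _, _ => ⟨le_of_eq (lastQ_singleton u).symm, fun _ _ _ hne => absurd rfl hne⟩
  | v :: rest, u, fu, hfu, hwu, hg => by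
    simp only [checkGridFromH] at hg
    split at hg
    · rename_i fv hfv
      simp only [Bool.and_eq_true, decide_eq_true_eq] at hg
      obtain ⟨⟨huv, hcell⟩, hrest⟩ := hg
      have huv' : ((u : ℚ) : ℝ) ≤ v := by exact_mod_cast huv
      have hwv : ∀ y : ℝ, (v : ℝ) ≤ y → ((w : ℚ) : ℝ) ≤ reDigammaQuarter y :=
        fun y hy => hwu y (huv'.trans hy)
      have ih := gridFromH_sound h ht hhl w rest v fv hfv hwv hrest
      rw [lastQ_cons_cons]
      refine ⟨huv.trans ih.1, fun y h1 h2 _ => ?_⟩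
      rcases le_or_gt y (v : ℝ) with hyv | hyv
      · have pu := point_boundH h ht hhl hfu y (hwu y h1)
        have pv := point_boundH h ht hhl hfv y (hwu y h1)
        have hc : (((v - u) * D.slopeH logs hl : ℚ) : ℝ) ≤ ((fu + fv : ℚ) : ℝ) := by exact_mod_cast hcell
        push_cast at hc
        rw [abs_of_nonneg (by linarith : (0 : ℝ) ≤ y - u)] at pu
        rw [abs_of_nonpos (by linarith : y - (v : ℝ) ≤ 0)] at pv
        nlinarith [pu, pv, hc]
      · rcases rest with _ | ⟨x, rest'⟩
        · rw [lastQ_singleton] at h2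
          exact absurd h2 (not_le.2 hyv)
        · exact ih.2 y hyv.le h2 (List.cons_ne_nil _ _)
    · simp at hg

/-- **Soundness of a passing anchored grid with `H`** `(w, u :: v :: r)`, `0 ≤ u`. [folklore] -/
theorem agrid₂H_sound {Y0 : ℚ} (h : D.checkScalars Y0 = true) {cs : List (FI × FI)} {logs : List FI}
    (ht : D.tablesOK cs logs = true) {hl : List HTerm}
    (hhl : ∀ t ∈ hl, (1 ≤ t.p ∧ t.p ≤ D.logN) ∧ (1 ≤ t.q ∧ t.q ≤ D.logN)) {w : ℚ} {r : List ℚ} {u v : ℚ}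
    (hu : 0 ≤ u) (hg : D.checkAGrid₂H cs logs hl (w, u :: v :: r) = true) :
    u ≤ lastQ (u :: v :: r) ∧ ∀ y : ℝ, (u : ℝ) ≤ y → y ≤ lastQ (u :: v :: r) → 0 ≤ D.F y + Hval hl y := by
  simp only [checkAGrid₂H, Bool.and_eq_true, decide_eq_true_eq] at hg
  obtain ⟨hw, hgrid⟩ := hg
  have hu' : (0 : ℝ) ≤ u := by exact_mod_cast hu
  have hwu : ∀ y : ℝ, (u : ℝ) ≤ y → ((w : ℚ) : ℝ) ≤ reDigammaQuarter y := fun y hy => by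
    have h1 : ((w : ℚ) : ℝ) ≤ ((wLoQ D.prec u (D.mwAt u) : ℚ) : ℝ) := by exact_mod_cast hw
    exact (h1.trans (wLoQ_le _ _ _)).trans (reDigammaQuarter_mono (by
      rw [abs_of_nonneg hu', abs_of_nonneg (hu'.trans hy)]; exact hy))
  simp only [checkGrid₂H] at hgrid
  split at hgrid
  · rename_i fu hfu
    have hs := gridFromH_sound h ht hhl w (v :: r) u fu hfu hwu hgrid
    exact ⟨hs.1, fun y h1 h2 => hs.2 y h1 h2 (List.cons_ne_nil _ _)⟩
  · simp at hgrid

/-- **Tail soundness with the SOS bound.** `F_D + Hsos ≥ 0` on `[Y₀, ∞)`, `Y₀ ≥ 0`. [folklore] -/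
theorem tailH_sound {Y1 Y0 : ℚ} (h : D.checkScalars Y1 = true) {Z : SOSData} (htl : D.checkTailH Z Y0 = true)
    (hY : 0 ≤ Y0) : ∀ y : ℝ, (Y0 : ℝ) ≤ y → 0 ≤ D.F y + Z.Hsos y := by
  obtain ⟨hL, hh, hnd, hall, hlog, -, -, -⟩ := check_spec h
  unfold checkTailH at htl
  rw [Bool.and_eq_true, decide_eq_true_eq] at htl
  obtain ⟨hsos, htail⟩ := htl
  intro y hy
  have hY' : (0 : ℝ) ≤ Y0 := by exact_mod_cast hY
  have ht : ((0 : ℚ) : ℝ) ≤ ((wLoQ D.prec Y0 D.mwT - logPiHi + D.s - Z.sosBound D.nodeList D.a -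
      D.decayFI.hiQ / (1 / 4 + Y0 * Y0) : ℚ) : ℝ) := by exact_mod_cast htail
  push_cast at ht
  have h1 : ((wLoQ D.prec Y0 D.mwT : ℚ) : ℝ) ≤ reDigammaQuarter y :=
    (wLoQ_le _ _ _).trans (reDigammaQuarter_mono (by
      rw [abs_of_nonneg hY', abs_of_nonneg (hY'.trans hy)]; exact hy))
  have h2 : Real.log π ≤ ((logPiHi : ℚ) : ℝ) := logPiHi_ge
  have hdec := PWKernel.abs_cosTransform_kernelE_le (d := D.d) hL hh y
  have hCE : D.d.decayConst ≤ (D.decayFI.hiQ : ℝ) := FI.le_hiQ (mem_decayFI h)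
  have hC0 := decayConst_nonneg h
  have hD0 : (0 : ℝ) < 1 / 4 + (Y0 : ℝ) * Y0 := by nlinarith [mul_self_nonneg (Y0 : ℝ)]
  have hDy : (1 / 4 : ℝ) + (Y0 : ℝ) * Y0 ≤ 1 / 4 + y ^ 2 := by nlinarith
  have h3 : |cosTransform D.d.kernelE y| ≤ (D.decayFI.hiQ : ℝ) / (1 / 4 + (Y0 : ℝ) * Y0) :=
    hdec.trans ((div_le_div_of_nonneg_left hC0 hD0 hDy).trans
      (div_le_div_of_nonneg_right hCE hD0.le))
  -- the SOS bound for the comb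
  have hsb := SOSData.comb_sub_Hsos_le (Z := Z) (a := D.a) hsos hnd y
  rw [← List.sum_toFinset _ hnd] at hsb
  unfold F
  have h4 := neg_abs_le (cosTransform D.d.kernelE y)
  linarith [h1, h2, h3, h4, hsb, ht]

/-- `F_D + H` is even. [folklore] -/
theorem F_add_Hval_neg (hl : List HTerm) (y : ℝ) : D.F (-y) + Hval hl (-y) = D.F y + Hval hl y := by
  rw [F_neg, Hval_neg]

/-- **Anchored chain soundness with `H`.** [folklore] -/
theorem chain₂H_sound {Y1 Y0 : ℚ} (h : D.checkScalars Y1 = true) {cs : List (FI × FI)} {logs : List FI}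
    (ht : D.tablesOK cs logs = true) {Z : SOSData} {hl : List HTerm} (hH : D.checkHTerms₂ Z hl = true)
    (htl : D.checkTailH Z Y0 = true) :
    ∀ (gs : List (ℚ × List ℚ)) (st : ℚ), 0 ≤ st → chainOK (gs.map Prod.snd) st Y0 = true →
      (∀ g ∈ gs, D.checkAGrid₂H cs logs hl g = true) →
      st ≤ Y0 ∧ ∀ y : ℝ, (st : ℝ) ≤ y → y ≤ Y0 → 0 ≤ D.F y + Hval hl y
  | [], st, hst, hch, _ => by
    simp only [List.map_nil, chainOK, decide_eq_true_eq] at hch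
    subst hch
    refine ⟨le_rfl, fun y h1 _ => ?_⟩
    rw [(checkHTerms₂_spec hH).1, SOSData.Hval_hlist₂ _ (checkHTerms₂_spec hH).2.2]
    exact tailH_sound h htl hst y h1
  | (w, pts) :: rest, st, hst, hch, hgs => by
    have hhl := (checkHTerms₂_spec hH).2.1
    simp only [List.map_cons, chainOK, Bool.and_eq_true, decide_eq_true_eq] at hch
    obtain ⟨hhead, hrest⟩ := hch
    have hg : D.checkAGrid₂H cs logs hl (w, pts) = true := hgs (w, pts) (by simp)
    have hgs' : ∀ g' ∈ rest, D.checkAGrid₂H cs logs hl g' = true := fun g' hg' => hgs g' (by simp [hg'])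
    match pts, hhead, hg with
    | [], hhead, _ => simp at hhead
    | [x], hhead, _ =>
      simp only [List.head?_cons, Option.some.injEq] at hhead
      subst hhead
      have ih := chain₂H_sound h ht hH htl rest (lastQ [x]) (by simpa [lastQ] using hst) hrest hgs'
      simp only [lastQ] at ih
      exact ih
    | u :: v :: r, hhead, hg =>
      simp only [List.head?_cons, Option.some.injEq] at hhead
      subst hhead
      have hgr := agrid₂H_sound h ht hhl hst hg
      have ih := chain₂H_sound h ht hH htl rest (lastQ (u :: v :: r)) (hst.trans hgr.1) hrest hgs'
      refine ⟨hgr.1.trans ih.1, fun y h1 h2 => ?_⟩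
      rcases le_or_gt y (lastQ (u :: v :: r) : ℝ) with hy | hy
      · exact hgr.2 y h1 hy
      · exact ih.2 y hy.le h2

/-- **Soundness of the corrected pointwise checker.** If the scalar checks pass for `Y₀`, the tables
check, the correction list is the certificate's (`checkHTerms₂`), the SOS tail check passes for `Y₀`, and
a family of anchored grids whose point lists chain from `0` to `Y₀` passes grid by grid, then
`F_D(y) + Z.Hsos y ≥ 0` for every real `y`. [folklore] -/
theorem F_add_Hsos_nonneg_of_checks {Y1 Y0 : ℚ} (h : D.checkScalars Y1 = true) {cs : List (FI × FI)}
    {logs : List FI} (ht : D.tablesOK cs logs = true) {Z : SOSData} {hl : List HTerm}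
    (hH : D.checkHTerms₂ Z hl = true) (htl : D.checkTailH Z Y0 = true) (gs : List (ℚ × List ℚ))
    (hch : chainOK (gs.map Prod.snd) 0 Y0 = true) (hgs : ∀ g ∈ gs, D.checkAGrid₂H cs logs hl g = true)
    (y : ℝ) : 0 ≤ D.F y + Z.Hsos y := by
  rw [← SOSData.Hval_hlist₂ _ (checkHTerms₂_spec hH).2.2, ← (checkHTerms₂_spec hH).1]
  wlog hy : 0 ≤ y generalizing y with H
  · have := H (-y) (by linarith); rwa [F_add_Hval_neg] at this
  have hc := chain₂H_sound h ht hH htl gs 0 le_rfl hch hgs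
  rcases le_or_gt y (Y0 : ℝ) with hyY | hyY
  · exact hc.2 y (by exact_mod_cast hy) hyY
  · have := tailH_sound h htl hc.1 y hyY.le
    rw [(checkHTerms₂_spec hH).1, SOSData.Hval_hlist₂ _ (checkHTerms₂_spec hH).2.2]
    exact this

end PWData

end Summit.RiemannHypothesis.RiemannHypothesis.Theorems.SignCone

end
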